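import Summits.QuantumFields.YangMills.Theorems.UnitScaleTiltProp7TrueAvgBudgetSectorLetters
import Summits.QuantumFields.YangMills.Theorems.UnitScaleTiltProp7TrueLinPureGaugeIter
import Summits.QuantumFields.YangMills.Theorems.UnitScaleTiltProp7RLegsOfCovGrad
import HarnessLib

/-!
# Route `UnitScaleTilt`, crux K1 «MinimiserStabilityRegPr» (stmt-QuantumFields-19200), stub `stub_existenceMinimalOrbit` (EX), LANE II (B4★)∕(QB) —
# ★★★ THE (QB) KNIT: «TRUE AVERAGE ≤ TWISTED AVERAGE + LEGS» FOR EVERY `M₂(ℂ)`-VALUED ONE-FORM, FROM THE CURVED CORNER-FRAME LEGS ROW (R-LEGS)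
# `hQB_of_rlegs : ⟨(R-LEGS)⟩ → ⟨hQB of ✓Prop7EngOfTrueAvgBudget.hEng_of_trueAvgBudget, verbatim⟩`; hence (ENG) ⟸ (R-LEGS) ⟸ ★routeR's linear-response rows (hG)∕(hN′)

Cell `ym3-torus` (HUMAN RULING D-0037, YM ladder rung R3 — YM₃ on T³ is a rung, NOT d = 4, NOT infinite volume, NOT a mass gap, NOT Clay; the YM gap is NOT proved),
width seat `ym3-torus-px19` (gen 7; the lineage's (QB) pen: ★p1 g19 NAMER WORDS №5∕№10∕№11 «px19 flat + knit; curved `rlegs` = w4-20520»).  THEOREMS ONLY (0 `def`,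
0 `sorry`); `--supports stmt-QuantumFields-19200 --as helper`, count-neutral; nothing here claims the stub, the crux or any summit statement.  Part 2∕2 (part 1∕2 =
`…TrueAvgBudgetSectorLetters`).

THE ROW AND ITS INPUTS.  (QB) = the displayed hypothesis `hQB` of ✓`hEng_of_trueAvgBudget` (px19 g6): per `L` there are L-only `Cq Cq′ ≥ 0`, `eq > 0` with, for every member,
`n < K`, `0 < e ≤ eq`, `W ∈ RegPr F n K e`, the E′ recursion family `Q` and EVERY `A : PBond (F.P K) 0 → M₂(ℂ)`,
`Σ_ĉ ‖Q (K−n) A ĉ‖² ≤ 2·Σ_c ‖QTw W A c‖²_F + Cq·ℓ·(CURL_HS(W,A) + DIV_HS(W,A)) + Cq′·e·ℓ⁻¹·Σ_b ‖A b‖²`.  (R-LEGS) = the displayed conclusion of w4-20520's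
✓`Prop7RLegsOfCovGrad.rlegs_of_covGradLegs` (= px19 g6 SIGNATURE-0 `rlegs`): the curved corner-frame legs `r(c₋)A − Ū(ĉ)·r(c₊)A·Ū(ĉ)ᴴ` of the comb chart are `ℓ²`-bounded by
`Cr·ℓ·(CURL_HS + DIV_HS) + Cr′·e·ℓ⁻¹·Σ‖A‖²`, for every `A` (its proof modulo ★routeR's rows (hG)∕(hN′) is w4-20520's ✓`Prop7RLegsCovKnit.rlegs_of_linTower_rows`).
THE PROOF (part 1∕2's letters).  Sectors `A = A₁ + i·A₂ + τ·1`; `ℂ`-linearity of `Q` (✓`Prop7TrueLinPureGaugeIter.trueLinIter_add`∕`_smul`) and of the CLM `QTw W`; LEG on `A₁`, `A₂`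
(`10¹⁰L⁶e ≤ 1`) and ★`central_legs_identity_of_regPr` on `τ·1`; `norm_sq_le_of_sectors` per block bond; summed: `Σ_ĉ‖Q A ĉ‖² ≤ 2·FQ(A) + 12·(RLEGS_W(A₁) + RLEGS_W(A₂) + RLEGS_1(τ·1))`;
the two curved legs sums are `hR` at `A₁, A₂`, the flat one is px19 g6 ✓`rlegs_flat` ∘ the flat Weitzenböck ✓`Prop7TrueAvgBudgetFlat.sum_grad_sq_le_curlHS_add_divBHS_one` ∘
`curlHS_divHS_smul_one_bg`; `curlHS_divHS_sectors` and `sector_normSq_le_two_mul` re-assemble the right side.  Constants: `Cq = 12(Cr + Cf)`, `Cq′ = 24Cr′`, `eq = min(er, (10¹⁰L⁶)⁻¹)`.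

WHAT IS PROVED (ns `…Theorems.Prop7TrueAvgBudgetOfRLegs`): ★★★`hQB_of_rlegs` — (QB) verbatim from (R-LEGS) verbatim; ★★`hQB_of_covGradLegs` (∘ ✓`rlegs_of_covGradLegs`: from the
covariant-gradient legs row `hCov`); ★★`hEng_of_rlegs` (∘ ✓`hEng_of_trueAvgBudget`: the displayed E′ row `hEng` of ✓`Prop7DivRecoverySlots` ⟸ (R-LEGS)).
HONEST SCOPE.  A by-name knit; (R-LEGS) itself is NOT proved here; nothing of (REC), `hN06`, EX or the crux is proved; nothing continuum ∕ OS ∕ mass-gap ∕ Clay.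

References: T. Bałaban, CMP **99** (1985) 389–434 [Balaban1985BackgroundPropagators] ((3.4) p.391, (3.8)–(3.11) p.392, (3.13)–(3.15) p.393, Thm 3.11 p.416); CMP **98** (1985)
17–51 [Balaban1985Averaging] ((89)–(92) p.31, (97) p.32, (125)–(127) pp.36–37, (160) p.42); CMP **95** (1984) 17–40 [Balaban1984PropagatorsI] ((1.18)–(1.21) pp.19–21);
CMP **102** (1985) 277–309 [Balaban1985Variational] ((14) p.280, (44) p.285, (51) p.286, (135) p.298).
-/

set_option autoImplicit false

noncomputable section

open scoped BigOperators Matrix.Norms.L2Operator Matrix InnerProductSpace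

namespace Summit.QuantumFields.YangMills.Theorems.Prop7TrueAvgBudgetOfRLegs

open Literature.MathematicalPhysics.QuantumFieldTheory.Balaban1983to89
open Literature.MathematicalPhysics.QuantumFieldTheory.Balaban1983to89.T3ContinuumYM3Torus
open Literature.MathematicalPhysics.QuantumFieldTheory.Balaban1983to89.T3PrintedRegularMinimiser (RegPr)
open Finset T4Continuum BlockAveraging AveragingRT ExpMeanLog BlockAveragingEMLLinearised BlockAveragingEMLLinearisedBackground
open T3LevelShift (bondShift)
open T3PrintedRegularOrbits (sites_eq)
open B9Eq39Adjoint (curl divB)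
open B10Eq27TorusAxialLog (unitsField toUField transl)
open B9TorusCalculus (torusT)
open B7Prop3Flat (Fhat)
open B7Prop4Flat (linQIter)
open B11Eq103H1Complex (BondL2K)
open Literature.MathematicalPhysics.QuantumFieldTheory.Balaban1983to89.B4Eq19LatticeOperators (Zd)
open Summit.QuantumFields.YangMills.Theorems.Prop7SPrint (basePt)
open Summit.QuantumFields.YangMills.Theorems.Prop7SectET3Transport (periodsT3)
open Summit.QuantumFields.YangMills.Theorems.Prop7SectET3HilbertLetters (W₂ frobEquiv DstarL2)
open Summit.QuantumFields.YangMills.Theorems.Prop7SectET3WilsonHessian (DeltaEtaSlot)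
open Summit.QuantumFields.YangMills.Theorems.Prop7SectET3CombLetters (Qkc)
open Summit.QuantumFields.YangMills.Theorems.Prop7SymAvgTw (coordT3 frameTw QTw)
open Summit.QuantumFields.YangMills.Theorems.Prop7LegLemmaQTw (QTw_apply_eq_trueLinIter_sub_coarseGauge_T3)
open Summit.QuantumFields.YangMills.Theorems.Prop7TrueLinPureGaugeIter (trueLinIter_add trueLinIter_smul)
open Summit.QuantumFields.YangMills.Theorems.Prop7QTwSectors (exists_sector_fields ten7_of_ten10)
open Summit.QuantumFields.YangMills.Theorems.Prop7CornerFrameLegsFlatRow (rlegs_flat)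
open Summit.QuantumFields.YangMills.Theorems.Prop7TrueAvgBudgetFlat (sum_grad_sq_le_curlHS_add_divBHS_one)
open Summit.QuantumFields.YangMills.Theorems.Prop7TrueAvgBudgetSectorLetters (norm_sq_le_of_sectors sector_normSq_le_two_mul curlHS_divHS_sectors curlHS_divHS_smul_one_bg
  central_legs_identity_of_regPr)
open Summit.QuantumFields.YangMills.Theorems.Prop7RLegsOfCovGrad (rlegs_of_covGradLegs)
open Summit.QuantumFields.YangMills.Theorems.Prop7EngOfTrueAvgBudget (hEng_of_trueAvgBudget)

/-! ## §3 ★★★ The knit -/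

section Knit

/-- ★★★ **THE (QB) KNIT: (QB) FOR EVERY `A`, FROM THE CURVED CORNER-FRAME LEGS ROW.**  `hR` = ✓`Prop7RLegsOfCovGrad.rlegs_of_covGradLegs`'s conclusion (px19 g6 SIGNATURE-0 `rlegs`)
VERBATIM; conclusion = ✓`Prop7EngOfTrueAvgBudget.hEng_of_trueAvgBudget`'s `hQB` VERBATIM, with `Cq = 12(Cr + Cf)`, `Cq′ = 24Cr′`, `eq = min(er, (10¹⁰L⁶)⁻¹)` (`Cf` = ✓`rlegs_flat`'s constant).
Proof: §1–§2 + LEG on the two `𝔰𝔲(2)` sectors + `ℂ`-linearity + `hR` twice + ✓`rlegs_flat` + the flat Weitzenböck ✓`sum_grad_sq_le_curlHS_add_divBHS_one`.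
[cite: Balaban1985BackgroundPropagators, (3.11) p.392, (3.13)-(3.15) p.393; Balaban1985Averaging, (89)-(92) p.31, (125)-(127) pp.36-37, (160) p.42; Balaban1984PropagatorsI, (1.18)-(1.21) pp.19-21; Balaban1985Variational, (44) p.285, (51) p.286] -/
theorem hQB_of_rlegs
    (hR : ∀ (L : ℕ), 1 < L → ∃ Cr Cr' er : ℝ, 0 ≤ Cr ∧ 0 ≤ Cr' ∧ 0 < er ∧
      ∀ (F : T3Family), F.L = L → ∀ (n K : ℕ) (hnK : n < K) (e : ℝ) (W : GaugeField (F.P K) 0 (Matrix.specialUnitaryGroup (Fin 2) ℂ)),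
        0 < e → e ≤ er → RegPr F n K e W → ∀ (A : PBond (F.P K) 0 → Matrix (Fin 2) (Fin 2) ℂ),
        ∑ c : PBond (F.P n) 0,
          ‖fderiv ℂ (fun A : PBond (F.P K) 0 → Matrix (Fin 2) (Fin 2) ℂ => ((frameTw F n K hnK.le W A c.src : (Matrix (Fin 2) (Fin 2) ℂ)ˣ) : Matrix (Fin 2) (Fin 2) ℂ)) 0 A
              - ((Averaging.iter (fun i => blockAvg (P := F.P K) (j := i) (expMeanLogSU (n := Fin 2))) (K - n) W (bondShift (sites_eq F n K hnK.le) c) :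
                  Matrix.specialUnitaryGroup (Fin 2) ℂ) : Matrix (Fin 2) (Fin 2) ℂ)
                * fderiv ℂ (fun A : PBond (F.P K) 0 → Matrix (Fin 2) (Fin 2) ℂ => ((frameTw F n K hnK.le W A c.tgt : (Matrix (Fin 2) (Fin 2) ℂ)ˣ) : Matrix (Fin 2) (Fin 2) ℂ)) 0 A
                * star ((Averaging.iter (fun i => blockAvg (P := F.P K) (j := i) (expMeanLogSU (n := Fin 2))) (K - n) W (bondShift (sites_eq F n K hnK.le) c) :
                  Matrix.specialUnitaryGroup (Fin 2) ℂ) : Matrix (Fin 2) (Fin 2) ℂ)‖ ^ 2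
          ≤ Cr * (F.L : ℝ) ^ (K - n) * ((∑ x : Site (F.P K) 0, ∑ μ : Fin (F.P K).d, ∑ ν : Fin (F.P K).d,
                (if μ < ν then ∑ j : Fin 2, ∑ k : Fin 2,
                  ‖(curl (torusT (F.P K) 0) (fun κ z => unitsField (toUField W) ⟨z, κ⟩) (fun κ z => A ⟨z, κ⟩) μ ν x) j k‖ ^ 2 else 0))
              + (∑ x : Site (F.P K) 0, ∑ j : Fin 2, ∑ k : Fin 2,
                ‖(divB (torusT (F.P K) 0) (fun κ z => unitsField (toUField W) ⟨z, κ⟩) (fun κ z => A ⟨z, κ⟩) x) j k‖ ^ 2))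
            + Cr' * e * ((F.L : ℝ) ^ (K - n))⁻¹ * ∑ b : PBond (F.P K) 0, ‖A b‖ ^ 2) :
    ∀ (L : ℕ), 1 < L → ∃ Cq Cq' eq : ℝ, 0 ≤ Cq ∧ 0 ≤ Cq' ∧ 0 < eq ∧
      ∀ (F : T3Family), F.L = L → ∀ (n K : ℕ) (hnK : n < K) (e : ℝ) (W : GaugeField (F.P K) 0 (Matrix.specialUnitaryGroup (Fin 2) ℂ)),
        0 < e → e ≤ eq → RegPr F n K e W →
        ∀ (Q : (k : ℕ) → (PBond (F.P K) 0 → Matrix (Fin 2) (Fin 2) ℂ) → PBond (F.P K) k → Matrix (Fin 2) (Fin 2) ℂ), (∀ Y, Q 0 Y = Y) →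
        (∀ (k : ℕ) (Y : PBond (F.P K) 0 → Matrix (Fin 2) (Fin 2) ℂ) (c : PBond (F.P K) (k + 1)), Q (k + 1) Y c
          = (fderiv ℂ (eml : (Idx (F.P K) → Matrix (Fin 2) (Fin 2) ℂ) → Matrix (Fin 2) (Fin 2) ℂ)
                (fun i => ((loopHol (Averaging.iter (fun i => blockAvg (P := (F.P K)) (j := i) (expMeanLogSU (n := Fin 2))) k W) c i : Matrix.specialUnitaryGroup (Fin 2) ℂ) : Matrix (Fin 2) (Fin 2) ℂ))
                (fun i => covWalkSum (Averaging.iter (fun i => blockAvg (P := (F.P K)) (j := i) (expMeanLogSU (n := Fin 2))) k W) (Q k Y) (walk (emb c.src) (loopWord (F.P K).L c.dir (off i.1) i.2.1 i.2.2))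
                  * ((loopHol (Averaging.iter (fun i => blockAvg (P := (F.P K)) (j := i) (expMeanLogSU (n := Fin 2))) k W) c i : Matrix.specialUnitaryGroup (Fin 2) ℂ) : Matrix (Fin 2) (Fin 2) ℂ))
                * star ((corr (expMeanLogSU (n := Fin 2)) (Averaging.iter (fun i => blockAvg (P := (F.P K)) (j := i) (expMeanLogSU (n := Fin 2))) k W) c : Matrix.specialUnitaryGroup (Fin 2) ℂ) : Matrix (Fin 2) (Fin 2) ℂ)
              + ((corr (expMeanLogSU (n := Fin 2)) (Averaging.iter (fun i => blockAvg (P := (F.P K)) (j := i) (expMeanLogSU (n := Fin 2))) k W) c : Matrix.specialUnitaryGroup (Fin 2) ℂ) : Matrix (Fin 2) (Fin 2) ℂ)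
                * covWalkSum (Averaging.iter (fun i => blockAvg (P := (F.P K)) (j := i) (expMeanLogSU (n := Fin 2))) k W) (Q k Y) (walk (emb c.src) (List.replicate (F.P K).L (c.dir, true)))
                * star ((corr (expMeanLogSU (n := Fin 2)) (Averaging.iter (fun i => blockAvg (P := (F.P K)) (j := i) (expMeanLogSU (n := Fin 2))) k W) c : Matrix.specialUnitaryGroup (Fin 2) ℂ) : Matrix (Fin 2) (Fin 2) ℂ))) →
        ∀ (A : PBond (F.P K) 0 → Matrix (Fin 2) (Fin 2) ℂ),
          ∑ c : PBond (F.P K) (K - n), ‖Q (K - n) A c‖ ^ 2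
            ≤ 2 * (∑ c : PBond (F.P n) 0, ‖(frobEquiv.symm (QTw F n K hnK.le W A c) : W₂)‖ ^ 2)
              + Cq * (F.L : ℝ) ^ (K - n) * ((∑ x : Site (F.P K) 0, ∑ μ : Fin (F.P K).d, ∑ ν : Fin (F.P K).d,
                    (if μ < ν then ∑ j : Fin 2, ∑ k : Fin 2,
                      ‖(curl (torusT (F.P K) 0) (fun κ z => unitsField (toUField W) ⟨z, κ⟩) (fun κ z => A ⟨z, κ⟩) μ ν x) j k‖ ^ 2 else 0))
                  + (∑ x : Site (F.P K) 0, ∑ j : Fin 2, ∑ k : Fin 2,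
                    ‖(divB (torusT (F.P K) 0) (fun κ z => unitsField (toUField W) ⟨z, κ⟩) (fun κ z => A ⟨z, κ⟩) x) j k‖ ^ 2))
              + Cq' * e * ((F.L : ℝ) ^ (K - n))⁻¹ * (∑ b : PBond (F.P K) 0, ‖A b‖ ^ 2) := by
  intro L hL
  obtain ⟨Cr, Cr', er, hCr, hCr', her, hrow⟩ := hR L hL
  obtain ⟨Cf, hCf, hflegs⟩ := rlegs_flat L hL
  have hL0 : (0 : ℝ) < (L : ℝ) := by exact_mod_cast (lt_trans Nat.zero_lt_one hL)
  have h10 : (0 : ℝ) < (10 ^ 10 * (L : ℝ) ^ 6)⁻¹ := by positivity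
  refine ⟨12 * (Cr + Cf), 24 * Cr', min er (10 ^ 10 * (L : ℝ) ^ 6)⁻¹, by positivity, by positivity, lt_min her h10, ?_⟩
  intro F hF n K hnK e W he heq hreg Q hQ0 hQs A
  -- windows
  have her' : e ≤ er := heq.trans (min_le_left _ _)
  have hε10 : 10 ^ 10 * (F.L : ℝ) ^ 6 * e ≤ 1 := by
    have h1 : e ≤ (10 ^ 10 * (L : ℝ) ^ 6)⁻¹ := heq.trans (min_le_right _ _)
    rw [hF]
    have hpos : (0 : ℝ) < 10 ^ 10 * (L : ℝ) ^ 6 := by positivity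
    calc 10 ^ 10 * (L : ℝ) ^ 6 * e ≤ 10 ^ 10 * (L : ℝ) ^ 6 * (10 ^ 10 * (L : ℝ) ^ 6)⁻¹ := mul_le_mul_of_nonneg_left h1 hpos.le
      _ = 1 := mul_inv_cancel₀ hpos.ne'
  have hε7 : 10 ^ 7 * (F.L : ℝ) ^ 3 * e ≤ 1 := ten7_of_ten10 F he hε10
  have hℓ0 : (0 : ℝ) < (F.L : ℝ) ^ (K - n) := by rw [hF]; positivity
  -- the three sectors of `A`
  obtain ⟨A₁, A₂, τ, hA₁, hA₂, hAeq⟩ := exists_sector_fields A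
  have hA₁' : ∀ b, A₁ b ∈ skewAdjoint (Matrix (Fin 2) (Fin 2) ℂ) := fun b => skewAdjoint.mem_iff.2 (hA₁ b).1
  have hA₂' : ∀ b, A₂ b ∈ skewAdjoint (Matrix (Fin 2) (Fin 2) ℂ) := fun b => skewAdjoint.mem_iff.2 (hA₂ b).1
  have htr₁ : ∀ b, (A₁ b).trace = 0 := fun b => (hA₁ b).2
  have htr₂ : ∀ b, (A₂ b).trace = 0 := fun b => (hA₂ b).2
  -- ℂ-linearity of the true averages and of the comb chart
  have hQA : ∀ c' : PBond (F.P K) (K - n), Q (K - n) A c'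
      = Q (K - n) A₁ c' + Complex.I • Q (K - n) A₂ c' + Q (K - n) (fun b => τ b • (1 : Matrix (Fin 2) (Fin 2) ℂ)) c' := by
    intro c'
    rw [hAeq, show (fun b => A₁ b + Complex.I • A₂ b + τ b • (1 : Matrix (Fin 2) (Fin 2) ℂ))
        = A₁ + Complex.I • A₂ + (fun b => τ b • (1 : Matrix (Fin 2) (Fin 2) ℂ)) from rfl,
      trueLinIter_add W Q hQ0 hQs, trueLinIter_add W Q hQ0 hQs, trueLinIter_smul W Q hQ0 hQs]
  have hTA : ∀ c : PBond (F.P n) 0, QTw F n K hnK.le W A c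
      = QTw F n K hnK.le W A₁ c + Complex.I • QTw F n K hnK.le W A₂ c + QTw F n K hnK.le W (fun b => τ b • (1 : Matrix (Fin 2) (Fin 2) ℂ)) c := by
    intro c
    rw [hAeq, show (fun b => A₁ b + Complex.I • A₂ b + τ b • (1 : Matrix (Fin 2) (Fin 2) ℂ))
        = A₁ + Complex.I • A₂ + (fun b => τ b • (1 : Matrix (Fin 2) (Fin 2) ℂ)) from rfl,
      map_add, map_add, map_smul, Pi.add_apply, Pi.add_apply, Pi.smul_apply]
  -- the three pointwise legs identities
  have hL₁ := fun c : PBond (F.P n) 0 => QTw_apply_eq_trueLinIter_sub_coarseGauge_T3 F hnK.le he hε10 W hreg Q hQ0 hQs A₁ hA₁' htr₁ c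
  have hL₂ := fun c : PBond (F.P n) 0 => QTw_apply_eq_trueLinIter_sub_coarseGauge_T3 F hnK.le he hε10 W hreg Q hQ0 hQs A₂ hA₂' htr₂ c
  have hLτ := fun c : PBond (F.P n) 0 => central_legs_identity_of_regPr F hnK he hε7 W hreg Q hQ0 hQs τ c
  -- the pointwise bound, summed over the block bonds
  have hpt : ∀ c : PBond (F.P n) 0, ‖Q (K - n) A (bondShift (sites_eq F n K hnK.le) c)‖ ^ 2
      ≤ 2 * ‖(frobEquiv.symm (QTw F n K hnK.le W A c) : W₂)‖ ^ 2
        + 12 * (‖fderiv ℂ (fun A : PBond (F.P K) 0 → Matrix (Fin 2) (Fin 2) ℂ => ((frameTw F n K hnK.le W A c.src : (Matrix (Fin 2) (Fin 2) ℂ)ˣ) : Matrix (Fin 2) (Fin 2) ℂ)) 0 A₁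
              - ((Averaging.iter (fun i => blockAvg (P := F.P K) (j := i) (expMeanLogSU (n := Fin 2))) (K - n) W (bondShift (sites_eq F n K hnK.le) c) :
                  Matrix.specialUnitaryGroup (Fin 2) ℂ) : Matrix (Fin 2) (Fin 2) ℂ)
                * fderiv ℂ (fun A : PBond (F.P K) 0 → Matrix (Fin 2) (Fin 2) ℂ => ((frameTw F n K hnK.le W A c.tgt : (Matrix (Fin 2) (Fin 2) ℂ)ˣ) : Matrix (Fin 2) (Fin 2) ℂ)) 0 A₁
                * star ((Averaging.iter (fun i => blockAvg (P := F.P K) (j := i) (expMeanLogSU (n := Fin 2))) (K - n) W (bondShift (sites_eq F n K hnK.le) c) :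
                  Matrix.specialUnitaryGroup (Fin 2) ℂ) : Matrix (Fin 2) (Fin 2) ℂ)‖ ^ 2
            + ‖fderiv ℂ (fun A : PBond (F.P K) 0 → Matrix (Fin 2) (Fin 2) ℂ => ((frameTw F n K hnK.le W A c.src : (Matrix (Fin 2) (Fin 2) ℂ)ˣ) : Matrix (Fin 2) (Fin 2) ℂ)) 0 A₂
              - ((Averaging.iter (fun i => blockAvg (P := F.P K) (j := i) (expMeanLogSU (n := Fin 2))) (K - n) W (bondShift (sites_eq F n K hnK.le) c) :
                  Matrix.specialUnitaryGroup (Fin 2) ℂ) : Matrix (Fin 2) (Fin 2) ℂ)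
                * fderiv ℂ (fun A : PBond (F.P K) 0 → Matrix (Fin 2) (Fin 2) ℂ => ((frameTw F n K hnK.le W A c.tgt : (Matrix (Fin 2) (Fin 2) ℂ)ˣ) : Matrix (Fin 2) (Fin 2) ℂ)) 0 A₂
                * star ((Averaging.iter (fun i => blockAvg (P := F.P K) (j := i) (expMeanLogSU (n := Fin 2))) (K - n) W (bondShift (sites_eq F n K hnK.le) c) :
                  Matrix.specialUnitaryGroup (Fin 2) ℂ) : Matrix (Fin 2) (Fin 2) ℂ)‖ ^ 2
            + ‖(∑ j ∈ Finset.range (K - n), Fhat (F.P K).L (linQIter (F.P K).L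
                  (fun (z : Zd 3) (κ : Fin 3) => τ ⟨transl (basePt F n K) z, κ⟩ • (1 : Matrix (Fin 2) (Fin 2) ℂ)) j)
                  ((((F.P K).L : ℤ) ^ (K - n - j)) • (fun i : Fin 3 => coordT3 F n K hnK.le c.src i)))
              - (∑ j ∈ Finset.range (K - n), Fhat (F.P K).L (linQIter (F.P K).L
                  (fun (z : Zd 3) (κ : Fin 3) => τ ⟨transl (basePt F n K) z, κ⟩ • (1 : Matrix (Fin 2) (Fin 2) ℂ)) j)
                  ((((F.P K).L : ℤ) ^ (K - n - j)) • (fun i : Fin 3 => coordT3 F n K hnK.le c.tgt i)))‖ ^ 2) := by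
    intro c
    refine norm_sq_le_of_sectors _ _ _ _ _ ?_
    rw [hQA, hTA, hL₁ c, hL₂ c, hLτ c]
    simp only [smul_sub]
    abel
  -- the three legs rows
  have hR₁ := hrow F hF n K hnK e W he her' hreg A₁
  have hR₂ := hrow F hF n K hnK e W he her' hreg A₂
  have hR₃ := hflegs F hF n K hnK (fun b => τ b • (1 : Matrix (Fin 2) (Fin 2) ℂ))
  -- the flat Weitzenböck for the centre, and the centre's forms at `W`
  have hW₃ := sum_grad_sq_le_curlHS_add_divBHS_one (P := F.P K) (fun b => τ b • (1 : Matrix (Fin 2) (Fin 2) ℂ))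
  have hbg := curlHS_divHS_smul_one_bg F W τ
  -- the sector split of the forms and of the mass
  have hCD := curlHS_divHS_sectors F W A₁ A₂ hA₁ hA₂ τ
  have hS : (∑ b : PBond (F.P K) 0, ‖A₁ b‖ ^ 2) + (∑ b : PBond (F.P K) 0, ‖A₂ b‖ ^ 2)
      + (∑ b : PBond (F.P K) 0, ‖τ b • (1 : Matrix (Fin 2) (Fin 2) ℂ)‖ ^ 2) ≤ 2 * ∑ b : PBond (F.P K) 0, ‖A b‖ ^ 2 := by
    rw [← Finset.sum_add_distrib, ← Finset.sum_add_distrib, Finset.mul_sum]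
    refine Finset.sum_le_sum fun b _ => ?_
    have h := sector_normSq_le_two_mul (hA₁ b) (hA₂ b) (τ b)
    rw [hAeq]
    exact h
  -- reindex the left side and sum the pointwise bound
  have hre : (∑ c' : PBond (F.P K) (K - n), ‖Q (K - n) A c'‖ ^ 2)
      = ∑ c : PBond (F.P n) 0, ‖Q (K - n) A (bondShift (sites_eq F n K hnK.le) c)‖ ^ 2 :=
    (Equiv.sum_comp (bondShift (sites_eq F n K hnK.le)) (fun c' => ‖Q (K - n) A c'‖ ^ 2)).symm
  rw [hre]
  have hsum := Finset.sum_le_sum fun c (_ : c ∈ (Finset.univ : Finset (PBond (F.P n) 0))) => hpt c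
  rw [Finset.sum_add_distrib, ← Finset.mul_sum, ← Finset.mul_sum, Finset.sum_add_distrib, Finset.sum_add_distrib] at hsum
  -- the forms of `A` split along the sectors (rewrite the goal's `A` only inside the forms and the mass)
  have hCDA : ((∑ x : Site (F.P K) 0, ∑ μ : Fin (F.P K).d, ∑ ν : Fin (F.P K).d,
        (if μ < ν then ∑ j : Fin 2, ∑ k : Fin 2,
          ‖(curl (torusT (F.P K) 0) (fun κ z => unitsField (toUField W) ⟨z, κ⟩) (fun κ z => A ⟨z, κ⟩) μ ν x) j k‖ ^ 2 else 0))
      + (∑ x : Site (F.P K) 0, ∑ j : Fin 2, ∑ k : Fin 2,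
        ‖(divB (torusT (F.P K) 0) (fun κ z => unitsField (toUField W) ⟨z, κ⟩) (fun κ z => A ⟨z, κ⟩) x) j k‖ ^ 2))
      = ((∑ x : Site (F.P K) 0, ∑ μ : Fin (F.P K).d, ∑ ν : Fin (F.P K).d,
            (if μ < ν then ∑ j : Fin 2, ∑ k : Fin 2,
              ‖(curl (torusT (F.P K) 0) (fun κ z => unitsField (toUField W) ⟨z, κ⟩) (fun κ z => A₁ ⟨z, κ⟩) μ ν x) j k‖ ^ 2 else 0))
          + (∑ x : Site (F.P K) 0, ∑ j : Fin 2, ∑ k : Fin 2,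
            ‖(divB (torusT (F.P K) 0) (fun κ z => unitsField (toUField W) ⟨z, κ⟩) (fun κ z => A₁ ⟨z, κ⟩) x) j k‖ ^ 2))
        + ((∑ x : Site (F.P K) 0, ∑ μ : Fin (F.P K).d, ∑ ν : Fin (F.P K).d,
            (if μ < ν then ∑ j : Fin 2, ∑ k : Fin 2,
              ‖(curl (torusT (F.P K) 0) (fun κ z => unitsField (toUField W) ⟨z, κ⟩) (fun κ z => A₂ ⟨z, κ⟩) μ ν x) j k‖ ^ 2 else 0))
          + (∑ x : Site (F.P K) 0, ∑ j : Fin 2, ∑ k : Fin 2,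
            ‖(divB (torusT (F.P K) 0) (fun κ z => unitsField (toUField W) ⟨z, κ⟩) (fun κ z => A₂ ⟨z, κ⟩) x) j k‖ ^ 2))
        + ((∑ x : Site (F.P K) 0, ∑ μ : Fin (F.P K).d, ∑ ν : Fin (F.P K).d,
            (if μ < ν then ∑ j : Fin 2, ∑ k : Fin 2,
              ‖(curl (torusT (F.P K) 0) (fun κ z => unitsField (toUField W) ⟨z, κ⟩)
                  (fun κ z => τ ⟨z, κ⟩ • (1 : Matrix (Fin 2) (Fin 2) ℂ)) μ ν x) j k‖ ^ 2 else 0))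
          + (∑ x : Site (F.P K) 0, ∑ j : Fin 2, ∑ k : Fin 2,
            ‖(divB (torusT (F.P K) 0) (fun κ z => unitsField (toUField W) ⟨z, κ⟩)
                (fun κ z => τ ⟨z, κ⟩ • (1 : Matrix (Fin 2) (Fin 2) ℂ)) x) j k‖ ^ 2)) := by
    have h := hCD
    rw [hAeq]
    exact h
  -- nonnegativity of the sector forms and masses
  have hCD0 : ∀ (B : PBond (F.P K) 0 → Matrix (Fin 2) (Fin 2) ℂ), 0 ≤
      (∑ x : Site (F.P K) 0, ∑ μ : Fin (F.P K).d, ∑ ν : Fin (F.P K).d,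
          (if μ < ν then ∑ j : Fin 2, ∑ k : Fin 2,
            ‖(curl (torusT (F.P K) 0) (fun κ z => unitsField (toUField W) ⟨z, κ⟩) (fun κ z => B ⟨z, κ⟩) μ ν x) j k‖ ^ 2 else 0))
        + (∑ x : Site (F.P K) 0, ∑ j : Fin 2, ∑ k : Fin 2,
          ‖(divB (torusT (F.P K) 0) (fun κ z => unitsField (toUField W) ⟨z, κ⟩) (fun κ z => B ⟨z, κ⟩) x) j k‖ ^ 2) := by
    intro B
    refine add_nonneg (Finset.sum_nonneg fun _ _ => Finset.sum_nonneg fun _ _ => Finset.sum_nonneg fun _ _ => ?_)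
      (Finset.sum_nonneg fun _ _ => Finset.sum_nonneg fun _ _ => Finset.sum_nonneg fun _ _ => sq_nonneg _)
    split_ifs
    · exact Finset.sum_nonneg fun _ _ => Finset.sum_nonneg fun _ _ => sq_nonneg _
    · exact le_rfl
  have hCD₁0 := hCD0 A₁
  have hCD₂0 := hCD0 A₂
  have hCD₃0 := hCD0 (fun b => τ b • (1 : Matrix (Fin 2) (Fin 2) ℂ))
  have hS₃0 : 0 ≤ ∑ b : PBond (F.P K) 0, ‖τ b • (1 : Matrix (Fin 2) (Fin 2) ℂ)‖ ^ 2 := Finset.sum_nonneg fun _ _ => sq_nonneg _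
  have hcoef : 0 ≤ Cr' * e * ((F.L : ℝ) ^ (K - n))⁻¹ := mul_nonneg (mul_nonneg hCr' he.le) (inv_nonneg.mpr hℓ0.le)
  -- the mass slots of the two `𝔰𝔲(2)` sectors against the total mass
  have hmass : Cr' * e * ((F.L : ℝ) ^ (K - n))⁻¹ * (∑ b : PBond (F.P K) 0, ‖A₁ b‖ ^ 2)
      + Cr' * e * ((F.L : ℝ) ^ (K - n))⁻¹ * (∑ b : PBond (F.P K) 0, ‖A₂ b‖ ^ 2)
      ≤ Cr' * e * ((F.L : ℝ) ^ (K - n))⁻¹ * (2 * ∑ b : PBond (F.P K) 0, ‖A b‖ ^ 2) := by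
    rw [← mul_add]
    exact mul_le_mul_of_nonneg_left (by linarith) hcoef
  -- the unused cross products are non-negative
  have hx₁ := mul_nonneg (mul_nonneg hCf hℓ0.le) hCD₁0
  have hx₂ := mul_nonneg (mul_nonneg hCf hℓ0.le) hCD₂0
  have hx₃ := mul_nonneg (mul_nonneg hCr hℓ0.le) hCD₃0
  -- the flat legs of the centre through the centre's forms at `W`
  rw [← hbg] at hW₃
  have hR₃' := hR₃.trans (mul_le_mul_of_nonneg_left hW₃ (mul_nonneg hCf hℓ0.le))
  -- close by linear arithmetic over the displayed atoms
  rw [hCDA]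
  linarith [hsum, hR₁, hR₂, hR₃', hmass, hx₁, hx₂, hx₃]

/-- ★★ **(QB) FROM THE COVARIANT-GRADIENT LEGS ROW `hCov`** (w4-20520's ✓`Prop7RLegsOfCovGrad.rlegs_of_covGradLegs` ∘ §3). [cite: Balaban1985Averaging, (89)-(92) p.31, (160) p.42; Balaban1985Variational, (135) p.298] -/
theorem hQB_of_covGradLegs
    (hCov : ∀ (L : ℕ), 1 < L → ∃ Cr Cr' er : ℝ, 0 ≤ Cr ∧ 0 ≤ Cr' ∧ 0 < er ∧
      ∀ (F : T3Family), F.L = L → ∀ (n K : ℕ) (hnK : n < K) (e : ℝ) (W : GaugeField (F.P K) 0 (Matrix.specialUnitaryGroup (Fin 2) ℂ)),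
        0 < e → e ≤ er → RegPr F n K e W → ∀ (A : PBond (F.P K) 0 → Matrix (Fin 2) (Fin 2) ℂ),
        ∑ c : PBond (F.P n) 0,
          ‖fderiv ℂ (fun A : PBond (F.P K) 0 → Matrix (Fin 2) (Fin 2) ℂ => ((frameTw F n K hnK.le W A c.src : (Matrix (Fin 2) (Fin 2) ℂ)ˣ) : Matrix (Fin 2) (Fin 2) ℂ)) 0 A
              - ((Averaging.iter (fun i => blockAvg (P := F.P K) (j := i) (expMeanLogSU (n := Fin 2))) (K - n) W (bondShift (sites_eq F n K hnK.le) c) :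
                  Matrix.specialUnitaryGroup (Fin 2) ℂ) : Matrix (Fin 2) (Fin 2) ℂ)
                * fderiv ℂ (fun A : PBond (F.P K) 0 → Matrix (Fin 2) (Fin 2) ℂ => ((frameTw F n K hnK.le W A c.tgt : (Matrix (Fin 2) (Fin 2) ℂ)ˣ) : Matrix (Fin 2) (Fin 2) ℂ)) 0 A
                * star ((Averaging.iter (fun i => blockAvg (P := F.P K) (j := i) (expMeanLogSU (n := Fin 2))) (K - n) W (bondShift (sites_eq F n K hnK.le) c) :
                  Matrix.specialUnitaryGroup (Fin 2) ℂ) : Matrix (Fin 2) (Fin 2) ℂ)‖ ^ 2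
          ≤ Cr * (F.L : ℝ) ^ (K - n) * (∑ b : PBond (F.P K) 0, ∑ ν : Fin (F.P K).d,
                ‖((W ⟨b.src, ν⟩ : Matrix.specialUnitaryGroup (Fin 2) ℂ) : Matrix (Fin 2) (Fin 2) ℂ) * A ⟨b.src.shift ν, b.dir⟩
                    * star ((W ⟨b.src, ν⟩ : Matrix.specialUnitaryGroup (Fin 2) ℂ) : Matrix (Fin 2) (Fin 2) ℂ) - A b‖ ^ 2)
            + Cr' * e * ((F.L : ℝ) ^ (K - n))⁻¹ * ∑ b : PBond (F.P K) 0, ‖A b‖ ^ 2) :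
    ∀ (L : ℕ), 1 < L → ∃ Cq Cq' eq : ℝ, 0 ≤ Cq ∧ 0 ≤ Cq' ∧ 0 < eq ∧
      ∀ (F : T3Family), F.L = L → ∀ (n K : ℕ) (hnK : n < K) (e : ℝ) (W : GaugeField (F.P K) 0 (Matrix.specialUnitaryGroup (Fin 2) ℂ)),
        0 < e → e ≤ eq → RegPr F n K e W →
        ∀ (Q : (k : ℕ) → (PBond (F.P K) 0 → Matrix (Fin 2) (Fin 2) ℂ) → PBond (F.P K) k → Matrix (Fin 2) (Fin 2) ℂ), (∀ Y, Q 0 Y = Y) →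
        (∀ (k : ℕ) (Y : PBond (F.P K) 0 → Matrix (Fin 2) (Fin 2) ℂ) (c : PBond (F.P K) (k + 1)), Q (k + 1) Y c
          = (fderiv ℂ (eml : (Idx (F.P K) → Matrix (Fin 2) (Fin 2) ℂ) → Matrix (Fin 2) (Fin 2) ℂ)
                (fun i => ((loopHol (Averaging.iter (fun i => blockAvg (P := (F.P K)) (j := i) (expMeanLogSU (n := Fin 2))) k W) c i : Matrix.specialUnitaryGroup (Fin 2) ℂ) : Matrix (Fin 2) (Fin 2) ℂ))
                (fun i => covWalkSum (Averaging.iter (fun i => blockAvg (P := (F.P K)) (j := i) (expMeanLogSU (n := Fin 2))) k W) (Q k Y) (walk (emb c.src) (loopWord (F.P K).L c.dir (off i.1) i.2.1 i.2.2))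
                  * ((loopHol (Averaging.iter (fun i => blockAvg (P := (F.P K)) (j := i) (expMeanLogSU (n := Fin 2))) k W) c i : Matrix.specialUnitaryGroup (Fin 2) ℂ) : Matrix (Fin 2) (Fin 2) ℂ))
                * star ((corr (expMeanLogSU (n := Fin 2)) (Averaging.iter (fun i => blockAvg (P := (F.P K)) (j := i) (expMeanLogSU (n := Fin 2))) k W) c : Matrix.specialUnitaryGroup (Fin 2) ℂ) : Matrix (Fin 2) (Fin 2) ℂ)
              + ((corr (expMeanLogSU (n := Fin 2)) (Averaging.iter (fun i => blockAvg (P := (F.P K)) (j := i) (expMeanLogSU (n := Fin 2))) k W) c : Matrix.specialUnitaryGroup (Fin 2) ℂ) : Matrix (Fin 2) (Fin 2) ℂ)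
                * covWalkSum (Averaging.iter (fun i => blockAvg (P := (F.P K)) (j := i) (expMeanLogSU (n := Fin 2))) k W) (Q k Y) (walk (emb c.src) (List.replicate (F.P K).L (c.dir, true)))
                * star ((corr (expMeanLogSU (n := Fin 2)) (Averaging.iter (fun i => blockAvg (P := (F.P K)) (j := i) (expMeanLogSU (n := Fin 2))) k W) c : Matrix.specialUnitaryGroup (Fin 2) ℂ) : Matrix (Fin 2) (Fin 2) ℂ))) →
        ∀ (A : PBond (F.P K) 0 → Matrix (Fin 2) (Fin 2) ℂ),
          ∑ c : PBond (F.P K) (K - n), ‖Q (K - n) A c‖ ^ 2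
            ≤ 2 * (∑ c : PBond (F.P n) 0, ‖(frobEquiv.symm (QTw F n K hnK.le W A c) : W₂)‖ ^ 2)
              + Cq * (F.L : ℝ) ^ (K - n) * ((∑ x : Site (F.P K) 0, ∑ μ : Fin (F.P K).d, ∑ ν : Fin (F.P K).d,
                    (if μ < ν then ∑ j : Fin 2, ∑ k : Fin 2,
                      ‖(curl (torusT (F.P K) 0) (fun κ z => unitsField (toUField W) ⟨z, κ⟩) (fun κ z => A ⟨z, κ⟩) μ ν x) j k‖ ^ 2 else 0))
                  + (∑ x : Site (F.P K) 0, ∑ j : Fin 2, ∑ k : Fin 2,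
                    ‖(divB (torusT (F.P K) 0) (fun κ z => unitsField (toUField W) ⟨z, κ⟩) (fun κ z => A ⟨z, κ⟩) x) j k‖ ^ 2))
              + Cq' * e * ((F.L : ℝ) ^ (K - n))⁻¹ * (∑ b : PBond (F.P K) 0, ‖A b‖ ^ 2) :=
  hQB_of_rlegs (rlegs_of_covGradLegs hCov)

/-- ★★ **(ENG) ⟸ (R-LEGS)**: the displayed E′ engine row `hEng` of ✓`Prop7DivRecoverySlots.hN06_of_divRecovery` (= ✓p702330's binder, SKELETON v1.2 :94) follows from the curved
corner-frame legs row alone — ✓`Prop7EngOfTrueAvgBudget.hEng_of_trueAvgBudget` (px19 g6) ∘ ★★★`hQB_of_rlegs`. [cite: Balaban1985BackgroundPropagators, Thm 3.11 p.416, (3.13)-(3.15) p.393; Balaban1985Variational, (14) p.280, (44) p.285] -/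
theorem hEng_of_rlegs (c₀ cB a₀ : ℕ → ℝ) [∀ L : ℕ, Fact (0 < c₀ L)] [∀ L : ℕ, Fact (0 < cB L)]
    (ha₀ : ∀ L : ℕ, 1 < L → 0 < a₀ L)
    (hR : ∀ (L : ℕ), 1 < L → ∃ Cr Cr' er : ℝ, 0 ≤ Cr ∧ 0 ≤ Cr' ∧ 0 < er ∧
      ∀ (F : T3Family), F.L = L → ∀ (n K : ℕ) (hnK : n < K) (e : ℝ) (W : GaugeField (F.P K) 0 (Matrix.specialUnitaryGroup (Fin 2) ℂ)),
        0 < e → e ≤ er → RegPr F n K e W → ∀ (A : PBond (F.P K) 0 → Matrix (Fin 2) (Fin 2) ℂ),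
        ∑ c : PBond (F.P n) 0,
          ‖fderiv ℂ (fun A : PBond (F.P K) 0 → Matrix (Fin 2) (Fin 2) ℂ => ((frameTw F n K hnK.le W A c.src : (Matrix (Fin 2) (Fin 2) ℂ)ˣ) : Matrix (Fin 2) (Fin 2) ℂ)) 0 A
              - ((Averaging.iter (fun i => blockAvg (P := F.P K) (j := i) (expMeanLogSU (n := Fin 2))) (K - n) W (bondShift (sites_eq F n K hnK.le) c) :
                  Matrix.specialUnitaryGroup (Fin 2) ℂ) : Matrix (Fin 2) (Fin 2) ℂ)
                * fderiv ℂ (fun A : PBond (F.P K) 0 → Matrix (Fin 2) (Fin 2) ℂ => ((frameTw F n K hnK.le W A c.tgt : (Matrix (Fin 2) (Fin 2) ℂ)ˣ) : Matrix (Fin 2) (Fin 2) ℂ)) 0 A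
                * star ((Averaging.iter (fun i => blockAvg (P := F.P K) (j := i) (expMeanLogSU (n := Fin 2))) (K - n) W (bondShift (sites_eq F n K hnK.le) c) :
                  Matrix.specialUnitaryGroup (Fin 2) ℂ) : Matrix (Fin 2) (Fin 2) ℂ)‖ ^ 2
          ≤ Cr * (F.L : ℝ) ^ (K - n) * ((∑ x : Site (F.P K) 0, ∑ μ : Fin (F.P K).d, ∑ ν : Fin (F.P K).d,
                (if μ < ν then ∑ j : Fin 2, ∑ k : Fin 2,
                  ‖(curl (torusT (F.P K) 0) (fun κ z => unitsField (toUField W) ⟨z, κ⟩) (fun κ z => A ⟨z, κ⟩) μ ν x) j k‖ ^ 2 else 0))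
              + (∑ x : Site (F.P K) 0, ∑ j : Fin 2, ∑ k : Fin 2,
                ‖(divB (torusT (F.P K) 0) (fun κ z => unitsField (toUField W) ⟨z, κ⟩) (fun κ z => A ⟨z, κ⟩) x) j k‖ ^ 2))
            + Cr' * e * ((F.L : ℝ) ^ (K - n))⁻¹ * ∑ b : PBond (F.P K) 0, ‖A b‖ ^ 2) :
    ∀ (L : ℕ), 1 < L → ∃ γE κD κQ θE eE : ℝ, 0 < γE ∧ 0 ≤ κD ∧ 0 ≤ κQ ∧ 0 ≤ θE ∧ 0 < eE ∧
      ∀ (F : T3Family), F.L = L → ∀ (n K : ℕ) (hnK : n < K) (e : ℝ) (W : GaugeField (F.P K) 0 (Matrix.specialUnitaryGroup (Fin 2) ℂ)),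
        0 < e → e ≤ eE → RegPr F n K e W →
        ∀ y : BondL2K ℂ 3 (periodsT3 F K) (c₀ F.L) W₂,
          γE * ‖y‖ ^ 2 ≤ RCLike.re ⟪y, DeltaEtaSlot F n K (c₀ F.L) W y⟫_ℂ + κD * ‖DstarL2 F n K (c₀ F.L) W y‖ ^ 2
            + κQ * ((a₀ F.L * (c₀ F.L / cB F.L) * ((F.L : ℝ) ^ (K - n)) ^ 3) * ‖Qkc F n K hnK.le (c₀ F.L) (cB F.L) W y‖ ^ 2) + θE * e * ‖y‖ ^ 2 :=
  hEng_of_trueAvgBudget c₀ cB a₀ ha₀ (hQB_of_rlegs hR)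

end Knit

end Summit.QuantumFields.YangMills.Theorems.Prop7TrueAvgBudgetOfRLegs

end
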